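import Summits.NavierStokesRegularity.OSWSelfSimilar.SheetRPointwiseDatumOfRecord
import HarnessLib

/-!
# SHEET-ℝ frame: THE BASE SOLUTION OPERATOR OF RECORD as a kernel object (row #4), the (S1) hypothesis TRIMMED to its one certified
# inequality (row #10), and the word with SEVEN named hypotheses

HONEST FRAMING (cell ns-blowup GROUP B / zone Z3, cases Z3-SR-CERT + Z3-SR-SPEC; 1-D MODEL certificate (viscous gCLM/OSW sheet on the line at
`(a, c_l, ε) = (1/5, 1/2, 1)`); computer-assisted frame; not Euler/NS; «violates: none — MODEL»).  After `SheetRPointwiseDatumOfRecord` (row #3 = the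
(C1) pointwise datum, KERNEL; `certifiedProfile_word_ofRecord₈`) two more hypothesis-ledger rows of `certifiedProfile_word_ofRecord` are plumbing,
not arithmetic:

* ROW #4 `S₀, hS₀` — THE base solution operator of `B_λ` at the centre of record.  It EXISTS in the kernel
  (`exists_baseSolutionOperator_ofRecord`) and is unique; here it becomes a DEFINED object **`baseSolutionOperator`** (`Classical.choose`), with
  `baseSolutionOperator_eq` (the weak equation for every right-hand side), `norm_baseSolutionOperator_le` (`‖S₀ g‖ ≤ 2‖g‖`) and
  `eq_baseSolutionOperator` (any energy-class weak solution of the same equation IS `S₀ g`).  Rows #5–#7 (capacitance inverse, `K_Nw`, `ε_N`) are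
  henceforth interval sentences about THIS defined operator.
* ROW #10 `hS1 : GardingDataKC 8 _ d V K D₀ D₁ V₀ (1/5) (3/20)` — a structure of EIGHT fields of which seven (measurability of drift and potential,
  `D₀, D₁ ≥ 0`, `|d ξ| ≤ D₀ + D₁|ξ|`, `|V| ≤ V₀`, `0 < c`) hold for EVERY centre by `SheetRCertificateAssembly.coef_bounds`
  (`D₀ = |a|√(π/4L)·‖Ω̄‖_w`, `D₁ = ½`, `V₀ = 1 + H₀ + |λ|`): **`gardingDataKC_of_isCentre`** (generic `L, a, λ, Ω, K, c, m`).  What remains of row #10 is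
  its `garding` field ALONE — the Gram-certified Gårding inequality of record (`CertificateViscousSheetRSpectrum` S1 / `…SpectrumB`).
* **`certifiedProfile_word_ofRecord₇`** — the word for the objects of record with rows #1 #2 #3 #4 #8a #9 #13 #14 discharged and #10 trimmed: SEVEN
  named hypotheses, each ONE interval sentence of record about defined objects: #5 `f, ℓ, Nmat, hN₁, hN₂` · #6 `hKNwB` · #7 `hepsNB` · #8b `hηB` ·
  #10 `hS1` (the bare Gårding inequality) · #11 `hPD` · #12 `hFD`.  Conclusion verbatim.
One definition with body (`baseSolutionOperator`, disclosed); no named fact.  WHAT THIS IS NOT: not NS; no interval sentence is proved here; «a named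
operator is not a certified inverse, and a certified MODEL profile is not an NS blow-up».
-/

noncomputable section

namespace Summit.NavierStokesRegularity.OSWSelfSimilar
namespace SheetRCertifiedProfileOfRecordSeven

open _root_.MeasureTheory _root_.Set _root_.Filter _root_.Real _root_.Metric Literature.Analysis.Fourier SheetRWeakProfilePV SheetRWeakToStrong
  SheetREnergyClass SheetRWeightedMeasure SheetREnergySpace SheetRLinearisedTests SheetRTestSpace SheetRLinearisedFormBounds
  SheetRSolutionOperator SheetRComplexPivot SheetRAssemblyOperators SheetRCertificateAssembly SheetRGeneratorOddWeak SheetROddClass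
  SheetRResolventOddClass SheetREvansOdd SheetRSpectrumWindingLists SheetRSpectrumOddAssembly SheetRSpectrumOddAssemblyReal SheetRWeakEigenReal
  SheetRPerturbedResolventC SheetRLinearisationPerturbation SheetRTimeShiftModeWeak SheetRTimeShiftModeWeakEigen SheetRCentreReencoding
  SheetRSpectrumStepRule SheetRSpectrumPointCertificate SheetRResolventConj SheetRSpectrumPointAssembly SheetRSpectrumEndToEnd
  SheetRSpectrumPointEndToEnd SheetRCertificateWeakZero SheetRCertificateCoercivity SheetRCertificateAssemblyB SheetRSpectrumCertifiedProfile
  SheetRFrameCentre SheetRCentreOfRecord SheetRCentreOfRecordValue SheetRLiftOfRecord SheetRCayleySubstitution SheetRFrameCentreVelocity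
  SheetRFrameCentreResidual SheetRCertifiedProfileOfRecord SheetRPointwiseDatumOfRecord SheetRPerturbedPair
  Literature.Analysis.OperatorTheory CertificateViscousSheetR Matrix Finset
open scoped Topology ENNReal InnerProductSpace ContDiff BigOperators

/-! ### §1 Row #10 trimmed: a Gårding datum from a centre and the bare inequality -/

/-- **`GardingDataKC` FROM A CENTRE AND THE BARE GÅRDING INEQUALITY.**  For any centre `Ω` (`IsCentre L Ω Ω₁ H₀`), any bounded `K : Esp L → W L`,
any `c > 0` and `m`: the measurability and growth fields of `GardingDataKC L _ (drift a Ω) (potential L λ Ω) K D₀ D₁ V₀ c m` hold with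
`D₀ = |a|·√(π/4L)·(∫ w Ω²)^{1/2}`, `D₁ = ½`, `V₀ = 1 + H₀ + |λ|` (`coef_bounds`), so the datum IS its `garding` field.  MODEL frame; not NS. [folklore] -/
theorem gardingDataKC_of_isCentre {L : ℝ} (hL : 0 < L) (lam a : ℝ) {Ω Ω₁ : ℝ → ℝ} {H₀ : ℝ} (hc : IsCentre L Ω Ω₁ H₀)
    (K : Esp L hL →L[ℝ] W L) {c : ℝ} (m : ℝ) (hcpos : 0 < c)
    (hg : ∀ vp : testSpace,
      c * (∫ ξ, (L ^ 2 + ξ ^ 2) * vp.1.2 ξ ^ 2) + m * ∫ ξ, (L ^ 2 + ξ ^ 2) * vp.1.1 ξ ^ 2 ≤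
        linForm L (drift a Ω) (potential L lam Ω) vp.1.1 vp.1.2 vp.1.1 vp.1.2
          + ∫ y, (L ^ 2 + y ^ 2) * (((K (jmap hL vp) : W L) : ℝ → ℝ) y * vp.1.1 y)) :
    GardingDataKC L hL (drift a Ω) (potential L lam Ω) K
      (|a| * (Real.sqrt (π / (4 * L)) * Real.sqrt (∫ y, (L ^ 2 + y ^ 2) * Ω y ^ 2))) (1 / 2) (1 + H₀ + |lam|) c m := by
  obtain ⟨hdm, hVm, hd, hV⟩ := coef_bounds hL lam a hc
  exact
    { d_meas := hdm
      V_meas := hVm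
      D₀_nonneg := by positivity
      D₁_nonneg := by norm_num
      d_le := fun ξ => by rw [one_div_mul_eq_div]; linarith [hd ξ]
      V_le := hV
      c_pos := hcpos
      garding := hg }

/-- **ROW #10 FOR THE CENTRE AND LIFT OF RECORD**: the (S1) datum `GardingDataKC 8 _ (drift (1/5) Ω̄) (potential 8 4 Ω̄) (−PopC̄ + 4⟪h,·⟫h) D₀ ½ V₀ (1/5) (3/20)`
from the bare Gram-certified inequality (`c₂ = 1/5`, `c₁ + γ = 3/20`).  MODEL frame; not NS. [folklore] -/
theorem gardingDataKC_ofRecord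
    (hg : ∀ vp : testSpace,
      1 / 5 * (∫ ξ, ((8:ℝ) ^ 2 + ξ ^ 2) * vp.1.2 ξ ^ 2) + 3 / 20 * ∫ ξ, ((8:ℝ) ^ 2 + ξ ^ 2) * vp.1.1 ξ ^ 2 ≤
        linForm 8 (drift (1 / 5) centreOfRecord) (potential 8 4 centreOfRecord) vp.1.1 vp.1.2 vp.1.1 vp.1.2
          + ∫ y, ((8:ℝ) ^ 2 + y ^ 2) *
            ((((-PopC eight_pos 4 (1 / 5) isCentre_centreOfRecord
                + ((4 : ℝ) • ((innerSL ℝ liftOfRecord).comp (ιE eight_pos))).smulRight liftOfRecord) (jmap eight_pos vp) : W 8) : ℝ → ℝ) y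
              * vp.1.1 y)) :
    GardingDataKC 8 eight_pos (drift (1 / 5) centreOfRecord) (potential 8 4 centreOfRecord)
      (-PopC eight_pos 4 (1 / 5) isCentre_centreOfRecord + ((4 : ℝ) • ((innerSL ℝ liftOfRecord).comp (ιE eight_pos))).smulRight liftOfRecord)
      (|(1 / 5 : ℝ)| * (Real.sqrt (π / (4 * 8)) * Real.sqrt (∫ y, ((8:ℝ) ^ 2 + y ^ 2) * centreOfRecord y ^ 2))) (1 / 2) (1 + centreH₀ + |(4:ℝ)|)
      (1 / 5) (3 / 20) :=
  gardingDataKC_of_isCentre eight_pos 4 (1 / 5) isCentre_centreOfRecord _ (3 / 20) (by norm_num) hg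

/-! ### §2 Row #4 as a defined object: the base solution operator of record -/

/-- **THE BASE SOLUTION OPERATOR OF RECORD** `S₀ : W 8 →L Esp 8` — the solution operator of the weak equation of `B_λ` (`λ = 4`, `a = 1/5`) at the
centre of record, chosen from the kernel existence statement `exists_baseSolutionOperator_ofRecord` (unique by `eq_baseSolutionOperator`).
Definition with body (`Classical.choose`); MODEL frame; not NS. [folklore] -/
def baseSolutionOperator : W 8 →L[ℝ] Esp 8 eight_pos := exists_baseSolutionOperator_ofRecord.choose

/-- `S₀ g` solves the weak equation `B_λ(S₀ g; v) = ⟨g, w v⟩` for every compactly supported test. [folklore] -/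
theorem baseSolutionOperator_eq (g : W 8) (v v₁ : ℝ → ℝ) (hv : IsCompactTest v v₁) :
    linForm 8 (drift (1 / 5) centreOfRecord) (potential 8 4 centreOfRecord) (prim (der (baseSolutionOperator g)))
        (der (baseSolutionOperator g)) v v₁
      = ∫ y, ((8:ℝ) ^ 2 + y ^ 2) * ((g : ℝ → ℝ) y * v y) :=
  exists_baseSolutionOperator_ofRecord.choose_spec.1 g v v₁ hv

/-- `‖S₀ g‖_E ≤ 2‖g‖_w`. [folklore] -/
theorem norm_baseSolutionOperator_le (g : W 8) : ‖baseSolutionOperator g‖ ≤ 2 * ‖g‖ :=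
  exists_baseSolutionOperator_ofRecord.choose_spec.2.1 g

/-- **Uniqueness**: an energy-class `p` solving the weak equation with right-hand side `g` IS `S₀ g`. [folklore] -/
theorem eq_baseSolutionOperator (g : W 8) (p : Esp 8 eight_pos)
    (hp : ∀ v v₁ : ℝ → ℝ, IsCompactTest v v₁ →
      linForm 8 (drift (1 / 5) centreOfRecord) (potential 8 4 centreOfRecord) (prim (der p)) (der p) v v₁
        = ∫ y, ((8:ℝ) ^ 2 + y ^ 2) * ((g : ℝ → ℝ) y * v y)) :
    p = baseSolutionOperator g :=
  exists_baseSolutionOperator_ofRecord.choose_spec.2.2 (fun v _ => ∫ y, ((8:ℝ) ^ 2 + y ^ 2) * ((g : ℝ → ℝ) y * v y)) p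
    (baseSolutionOperator g) hp (fun v v₁ hv => baseSolutionOperator_eq g v v₁ hv)

/-! ### §3 The word with SEVEN named hypotheses -/

/-- **EXISTENCE ∘ SPECTRUM FOR THE CENTRE AND LIFT OF RECORD — SEVEN HYPOTHESES.**  `certifiedProfile_word_ofRecord` (p528343) with rows #3 (pointwise
datum, `SheetRPointwiseDatumOfRecord`), #4 (`S₀ := baseSolutionOperator`), #8a (`integrable_weight_residual_sq_centreOfRecord`) DISCHARGED and row #10
TRIMMED to the bare Gårding inequality (`gardingDataKC_ofRecord`).  The seven remaining named hypotheses are the interval sentences of record: #5 the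
capacitance data `f, ℓ, Nmat` with the exact two-sided inverse `hN₁, hN₂` of `1 − C(S₀)`; #6 `hKNwB`; #7 `hepsNB`; #8b `hηB`; #10 `hS1`; #11 `hPD`;
#12 `hFD`.  Conclusion verbatim: ∃! δ in the `rEBR2`-ball solving the linearised weak equation at `Ω̄`, and for the centre `Ω* = Ω̄ + prim (der δ)`
«{σ : Re σ > −3/100 ∧ −DG(Ω*)|odd has a non-trivial weak eigenvector at σ} = {1}».  MODEL statement; not NS. [folklore] -/
theorem certifiedProfile_word_ofRecord₇
    {n : ℕ} (f : Fin n → W 8) (ℓ : Fin n → Esp 8 eight_pos →L[ℝ] ℝ) (Nmat : Matrix (Fin n) (Fin n) ℝ)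
    (hN₁ : (1 - capMatrix (fun i => baseSolutionOperator (f i)) ℓ) * Nmat = 1)
    (hN₂ : Nmat * (1 - capMatrix (fun i => baseSolutionOperator (f i)) ℓ) = 1)
    (hKNwB : ∀ g : W 8, ‖capInverse (fun i => baseSolutionOperator (f i)) ℓ Nmat (baseSolutionOperator g)‖ ≤ (KNwB : ℝ) * ‖g‖)
    (hepsNB : ∀ u : Esp 8 eight_pos, ‖PopC eight_pos 4 (1 / 5) isCentre_centreOfRecord u - ∑ i, ℓ i u • f i‖ ≤ (epsNBR : ℝ) * ‖u‖)
    (hηB : Real.sqrt (∫ y, ((8:ℝ) ^ 2 + y ^ 2) * (centreOfRecord y + 1 / 2 * y * centreOfRecordDeriv y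
      + 1 / 5 * (∫ s in (0 : ℝ)..y, hilbertTransform centreOfRecord s) * centreOfRecordDeriv y
      - hilbertTransform centreOfRecord y * centreOfRecord y - deriv centreOfRecordDeriv y) ^ 2) ≤ (etaB2 : ℝ))
    (hS1 : ∀ vp : testSpace,
      1 / 5 * (∫ ξ, ((8:ℝ) ^ 2 + ξ ^ 2) * vp.1.2 ξ ^ 2) + 3 / 20 * ∫ ξ, ((8:ℝ) ^ 2 + ξ ^ 2) * vp.1.1 ξ ^ 2 ≤
        linForm 8 (drift (1 / 5) centreOfRecord) (potential 8 4 centreOfRecord) vp.1.1 vp.1.2 vp.1.1 vp.1.2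
          + ∫ y, ((8:ℝ) ^ 2 + y ^ 2) *
            ((((-PopC eight_pos 4 (1 / 5) isCentre_centreOfRecord
                + ((4 : ℝ) • ((innerSL ℝ liftOfRecord).comp (ιE eight_pos))).smulRight liftOfRecord) (jmap eight_pos vp) : W 8) : ℝ → ℝ) y
              * vp.1.1 y))
    (hPD : PointData (resolventKC eight_pos _ (gardingDataKC_ofRecord hS1)) (ofRealW 8 liftOfRecord) (ofRealW 8 liftOfRecord) 4
      (evansOdd eight_pos _ (gardingDataKC_ofRecord hS1) ((innerSL ℂ (ofRealW 8 liftOfRecord)).comp (Wcodd 8).subtypeL)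
        (realOdd liftOfRecord liftOfRecord_mem_Wodd) 4))
    (hFD : MixedFarDatum (resolventKC eight_pos _ (gardingDataKC_ofRecord hS1)) (ofRealW 8 liftOfRecord) (ofRealW 8 liftOfRecord) 1
      ((3593635617 : ℝ) / 5000000000) ((331182857 : ℝ) / 250000000) ((802337581 : ℝ) / 500000000) ((1710547133 : ℝ) / 1000000000)) :
    ∃ δ : Esp 8 eight_pos, δ ∈ closedBall (0 : Esp 8 eight_pos) (rEBR2 : ℝ) ∧
      (∀ v v₁ : ℝ → ℝ, IsCompactTest v v₁ →
        linForm 8 (drift (1 / 5) centreOfRecord) (potential 8 4 centreOfRecord) (prim (der δ)) (der δ) v v₁ =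
          ∫ y, ((8:ℝ) ^ 2 + y ^ 2) * ((PopFun 8 4 (1 / 5) centreOfRecord centreOfRecordDeriv δ y
            - (centreOfRecord y + 1 / 2 * y * centreOfRecordDeriv y
              + 1 / 5 * (∫ s in (0 : ℝ)..y, hilbertTransform centreOfRecord s) * centreOfRecordDeriv y
              - hilbertTransform centreOfRecord y * centreOfRecord y - deriv centreOfRecordDeriv y)
            - QFun 8 (1 / 5) δ δ y) * v y)) ∧
      (∀ δ' ∈ closedBall (0 : Esp 8 eight_pos) (rEBR2 : ℝ),
        (∀ v v₁ : ℝ → ℝ, IsCompactTest v v₁ →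
          linForm 8 (drift (1 / 5) centreOfRecord) (potential 8 4 centreOfRecord) (prim (der δ')) (der δ') v v₁ =
            ∫ y, ((8:ℝ) ^ 2 + y ^ 2) * ((PopFun 8 4 (1 / 5) centreOfRecord centreOfRecordDeriv δ' y
              - (centreOfRecord y + 1 / 2 * y * centreOfRecordDeriv y
                + 1 / 5 * (∫ s in (0 : ℝ)..y, hilbertTransform centreOfRecord s) * centreOfRecordDeriv y
                - hilbertTransform centreOfRecord y * centreOfRecord y - deriv centreOfRecordDeriv y)
              - QFun 8 (1 / 5) δ' δ' y) * v y)) → δ' = δ) ∧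
      ∃ (Ωs₁ : ℝ → ℝ) (Hs : ℝ) (hcs : IsCentre 8 (fun y => centreOfRecord y + prim (der δ) y) Ωs₁ Hs),
        {σ : ℂ | ra < σ.re ∧ ∃ w : Wcodd 8, w ≠ 0 ∧
          IsWeakEigen eight_pos (-PopC eight_pos 4 (1 / 5) hcs + ((4 : ℝ) • ((innerSL ℝ liftOfRecord).comp (ιE eight_pos))).smulRight liftOfRecord)
            (drift (1 / 5) (fun y => centreOfRecord y + prim (der δ) y)) (potential 8 4 (fun y => centreOfRecord y + prim (der δ) y))
            ((innerSL ℂ (ofRealW 8 liftOfRecord)).comp (Wcodd 8).subtypeL) (realOdd liftOfRecord liftOfRecord_mem_Wodd) 4 σ w} = {1} :=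
  certifiedProfile_word_ofRecord₈ baseSolutionOperator baseSolutionOperator_eq f ℓ Nmat hN₁ hN₂ hKNwB hepsNB hηB
    (gardingDataKC_ofRecord hS1) hPD hFD

end SheetRCertifiedProfileOfRecordSeven
end Summit.NavierStokesRegularity.OSWSelfSimilar

end
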